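import Summits.ResolutionOfSingularities.ResolutionOfSingularities.Theorems.EquisingularLiftEquisingularLiftNatSmoothConeBlowupChart
import Summits.ResolutionOfSingularities.ResolutionOfSingularities.Theorems.EquisingularLiftEquisingularLiftNatOrdTwoOneBlowupCriterion
import Literature.AlgebraicGeometry.Resolution.HypersurfaceTransformChart
import Mathlib.Algebra.MvPolynomial.PDeriv
import HarnessLib

/-!
# [OURS · L1 W4.5(b) · EL♮(3)] T-EBETA-PRIME, ring core, part 2: ONE point blow-up resolves a hypersurface point with
# SMOOTH projectivised tangent cone, along the whole exceptional divisor — the (E-β′) / TIE-POINT device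

Support file of the crux chain w45b (cell `res-hironaka`, LADDER-RESOLUTION rung L, slot W4.5(b)), working crux
**EL♮ = `Theses.EquisingularLift.EquisingularLiftNat`** (stmt-ResolutionOfSingularities-20038) and its `n = 3` child
`EquisingularLiftNatThree` (stmt-ResolutionOfSingularities-20148), registered stub `stub_elnat_three_isolated_nonabs`
(line `sections`). OURS; NOT a statement of any manuscript; AI-written, weaker than expert review. Filed
`--supports stmt-ResolutionOfSingularities-20148 --as helper` by res-L1-w45b-stub-3 (self-dealt object T-EBETA-PRIME,
STATUS 2026-08-27T07:35Z). Part 1 = `…NatSmoothConeBlowupChart` (chart algebra: `G = tᵈ·(Φ(e) + tψ)`, exceptional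
fibre, strict-transform ideal, chart ring of `Bl_{V(I)} V(G)`).

SETTING (any commutative ring `A`): `x = (x₁, …, x_r)`, `I = (x)`, `B = A[I/xᵢ]` (`blowupAlgebra`), `t = xᵢ/1`,
`e_j = x_j/xᵢ`; `G = Φ(x) + Ψ`, `Φ` a form of degree `d`, `Ψ ∈ I^{d+1}`; strict transform `g₁ = Φ(e) + tψ` on the chart
(part 1, `exists_algebraMap_tangentCone_eq`), `Φᵢ = Φ(Tᵢ := 1)` the dehomogenisation, `Φ̄ᵢ` its reduction mod `I`.

* `strictTransform_notMem_sq_of_pderiv_notMem` — **the derivative test «smooth point of the tangent cone ⇒ order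
  one»**, for ANY `A` and `x` quasi-regular: at a prime `𝔐 ∋ t` of `B`, if some evaluated partial derivative
  `(∂Φᵢ/∂T_j)(e)`, `j ≠ i`, is not in `𝔐`, then `g₁ ∉ 𝔪_𝔐²` in `B_𝔐` (BGMW 3.6.4 (4) pattern: `∂/∂T_j` of the lift
  `Φᵢ + xᵢ q` of `g₁` to `A[T_l : l ≠ i]` is a unit at `𝔐`, while the relations of `A[T] ↠ B` lie in `I·A[T] ⊆ (t) ⊆ 𝔐`,
  Stacks 0BIQ; tree `notMem_sq_maximalIdeal_of_pderiv_notMem`);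
* `exists_pderiv_coneTransform_notMem_of_mem_span` — **the Jacobian packaging**: if
  `1 ∈ (Φ̄ᵢ) + (∂Φ̄ᵢ/∂T_j : j ≠ i)` in `(A/I)[T_j : j ≠ i]` (the affine piece of the projectivised tangent cone is SMOOTH
  over the centre), then at every prime `𝔐 ⊇ (t, g₁)` some `(∂Φᵢ/∂T_j)(e) ∉ 𝔐` (reduce modulo `t` along
  `B/(t) ≅ (A/I)[T]`, `blowupAlgebraQuotEquiv`);
* `isRegularLocalRing_quotient_span_algebraMap_of_notMem_sq` — Matsumura 14.2 at a prime of a regular ring, in any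
  model `S` of the local ring (bookkeeping);
* **`isRegularLocalRing_quotient_strictTransform`**, **`…_of_mem_span`** — for `A` and `A/I` REGULAR rings and `x`
  quasi-regular (so `B` is regular, Liu 8.1.19 (a), `blowupAlgebra.isRegularRing`): at every prime `𝔐 ⊇ (t, g₁)` of `B`
  passing the derivative test — under the Jacobian condition, at EVERY such prime — **the local ring `B_𝔐/(g₁)` of
  the strict transform is a regular local ring of dimension `dim B_𝔐 − 1`**: «the blow-up of `V(G)` along `V(I)` is
  regular along the exceptional divisor wherever the projectivised tangent cone is smooth»;
* `isRegularRing_quotient_strictTransform_of_mem_span` — the chart `B/(g₁) ≅ (A/(G))[Ī/x̄ᵢ]` is a REGULAR RING once,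
  in addition, `g₁` has order one at its maximal ideals OFF the exceptional divisor (where `Bl V(G) ≅ V(G) ∖ V(I)`).

Combined with part 1 (`B/(g₁) ≅ (A/(G))[Ī/x̄ᵢ]`, fibre `B/(g₁, t) ≅ (A/I)[T]/(Φ̄ᵢ)`) this is the local admissibility of
the (E-β′) centre `Bl_q(D)` at a tie point: regular along, and with exceptional fibre equal to, the smooth plane
curve `V(Φ̄)`. Not covered, and said so: the points OFF the exceptional divisor beyond the order-one hypothesis, and
the (E-β) case of res-L1-w45b-stub-4's T-EBETA-CHARTS (tangent cone = `m` concurrent lines, NOT smooth at the vertex,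
where the rescue is the `ϖ^{m+1} u` term — a different lemma). The S-F tie-cubic instance
(`Φ̄ = v T₁T₂(T₁+T₂) + w T₃³`) is the sequel file `…NatTieCubicBlowup`.

References: Matsumura, *Commutative Ring Theory*, Thm. 14.2, 19.3; Liu, *Algebraic Geometry and Arithmetic Curves*,
Thm. 8.1.19 (a); Bierstone–Grigoriev–Milman–Włodarczyk 2011, Lemma 3.6.4 (4) (pattern of proof); The Stacks Project,
Tags 0BIQ, 07Z3. Tree inputs: part 1, `…NatOrdTwoOneBlowupCriterion` (res-type-006: Matsumura 14.2/19.3 packaging),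
`HypersurfaceTransformChart` (`notMem_sq_maximalIdeal_of_pderiv_notMem`), `BlowupAlgebraPresentation`.
-/

set_option linter.dupNamespace false -- mandated namespace `Summit.<Summit>.<Problem>` of this single-conjunct summit

noncomputable section

namespace Summit.ResolutionOfSingularities.ResolutionOfSingularities.Cruxes.EquisingularLiftNat.Sections

open MvPolynomial IsLocalization IsLocalRing Literature.AlgebraicGeometry.Resolution

universe u

/-! ## Order one along the exceptional divisor: the derivative test and the Jacobian packaging -/

section OrderOne

variable {A : Type u} [CommRing A] {r : ℕ} (x : Fin r → A) (i : Fin r)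

/-- `Φ(e) = eval (dehomogenize i Φ)`: the cone transform is the chart evaluation of the dehomogenised form
(`blowupAlgebra.eval`, `T_j ↦ x_j/xᵢ`). [folklore] -/
theorem coneTransform_eq_eval_dehomogenize (Φ : MvPolynomial (Fin r) A) :
    MvPolynomial.aeval (blowupAlgebra.frac x i) Φ = blowupAlgebra.eval x i (dehomogenize i Φ) :=
  coneTransform_eq_aeval_dehomogenize x i Φ

/-- **The derivative test «smooth point of the tangent cone ⇒ order one».** For ANY ring `A` and `x` quasi-regular:
at a prime `𝔐` of the chart `A[I/xᵢ]` ON the exceptional divisor (`t ∈ 𝔐`), if for some `j ≠ i` the evaluated partial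
derivative `(∂Φᵢ/∂T_j)(e)` of the dehomogenised form does not lie in `𝔐`, then `g₁ = Φ(e) + tψ ∉ 𝔪_𝔐²` in
`A[I/xᵢ]_𝔐`. Proof: lift `g₁` to `p = Φᵢ + xᵢ q ∈ A[T_l : l ≠ i]` (`q` a lift of `ψ`); `∂p/∂T_j = ∂Φᵢ/∂T_j + xᵢ ∂q/∂T_j`
maps to `(∂Φᵢ/∂T_j)(e)` modulo `t ∈ 𝔐`, a unit at `𝔐`, while the relations of `A[T] ↠ A[I/xᵢ]` lie in
`I·A[T] ⊆ (t) ⊆ 𝔐` (Stacks 0BIQ), so the tree's `notMem_sq_maximalIdeal_of_pderiv_notMem` applies.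
[cite: BierstoneGrigorievMilmanWlodarczyk2011, Lemma 3.6.4 (4)] [cite: StacksProject, Tag 0BIQ]
[OURS · L1 W4.5b] T-EBETA-PRIME helper; NOT a statement of the manuscript. -/
theorem strictTransform_notMem_sq_of_pderiv_notMem (hx : IsQuasiRegular x) (Φ : MvPolynomial (Fin r) A)
    (ψ : blowupAlgebra (Ideal.span (Set.range x)) (x i))
    (𝔐 : Ideal (blowupAlgebra (Ideal.span (Set.range x)) (x i))) [𝔐.IsPrime]
    (hxi : algebraMap A (blowupAlgebra (Ideal.span (Set.range x)) (x i)) (x i) ∈ 𝔐)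
    (j : {j : Fin r // j ≠ i})
    (hd : blowupAlgebra.eval x i (MvPolynomial.pderiv j (dehomogenize i Φ)) ∉ 𝔐) :
    algebraMap (blowupAlgebra (Ideal.span (Set.range x)) (x i)) (Localization.AtPrime 𝔐)
        (MvPolynomial.aeval (blowupAlgebra.frac x i) Φ +
          algebraMap A (blowupAlgebra (Ideal.span (Set.range x)) (x i)) (x i) * ψ) ∉
      maximalIdeal (Localization.AtPrime 𝔐) ^ 2 := by
  classical
  -- adapted from `chartTransform_notMem_sq_of_pderiv_notMem` (…NatOrdTwoOneBlowupCriterion, the quadratic case)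
  let φ : MvPolynomial {l : Fin r // l ≠ i} A →+* blowupAlgebra (Ideal.span (Set.range x)) (x i) :=
    (blowupAlgebra.eval x i).toRingHom
  have hφ : Function.Surjective φ := blowupAlgebra.eval_surjective x i
  have hφe : ∀ p, φ p = blowupAlgebra.eval x i p := fun p => rfl
  obtain ⟨q, hq⟩ := hφ ψ
  let p : MvPolynomial {l : Fin r // l ≠ i} A := dehomogenize i Φ + MvPolynomial.C (x i) * q
  have hφC : ∀ a : A, φ (MvPolynomial.C a) = algebraMap A _ a := fun a => blowupAlgebra.eval_C x i a
  have hφp : φ p = MvPolynomial.aeval (blowupAlgebra.frac x i) Φ +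
      algebraMap A (blowupAlgebra (Ideal.span (Set.range x)) (x i)) (x i) * ψ := by
    simp only [p, map_add, map_mul, hφC, hq]
    rw [coneTransform_eq_eval_dehomogenize]
    rfl
  have hpd : MvPolynomial.pderiv j p =
      MvPolynomial.pderiv j (dehomogenize i Φ) + MvPolynomial.C (x i) * MvPolynomial.pderiv j q := by
    simp only [p, map_add, Derivation.leibniz, MvPolynomial.pderiv_C, smul_eq_mul, mul_zero, add_zero]
  have hφpd : φ (MvPolynomial.pderiv j p) =
      blowupAlgebra.eval x i (MvPolynomial.pderiv j (dehomogenize i Φ)) +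
        algebraMap A (blowupAlgebra (Ideal.span (Set.range x)) (x i)) (x i) * φ (MvPolynomial.pderiv j q) := by
    rw [hpd, map_add, map_mul, hφC]
    rfl
  have hKQ : ∀ w ∈ Ideal.span (Set.range x), φ (MvPolynomial.C w) ∈ 𝔐 := by
    intro w hw
    rw [hφC]
    refine ((Ideal.span_singleton_le_iff_mem _).mpr hxi) ?_
    -- `I · A[I/xᵢ] ⊆ (t)` (Stacks 07Z3 (2))
    rw [← map_blowupAlgebra_eq_span (blowupAlgebra.mem_span_range x i)]
    exact Ideal.mem_map_of_mem _ hw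
  have hp𝔐 : φ (MvPolynomial.pderiv j p) ∉ 𝔐 := by
    rw [hφpd]
    intro hmem
    apply hd
    have := 𝔐.sub_mem hmem (𝔐.mul_mem_right (φ (MvPolynomial.pderiv j q)) hxi)
    rwa [add_sub_cancel_right] at this
  have hker : RingHom.ker φ ≤ Ideal.map MvPolynomial.C (Ideal.span (Set.range x)) := by
    intro g hg
    rw [← blowupAlgebra.comap_eval_span_algebraMap_eq x i hx, Ideal.mem_comap]
    rw [RingHom.mem_ker] at hg
    change φ g ∈ _
    rw [hg]
    exact Ideal.zero_mem _
  have hsq := notMem_sq_maximalIdeal_of_pderiv_notMem φ hφ (Ideal.span (Set.range x)) hker 𝔐 hKQ j p hp𝔐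
  rwa [hφp] at hsq

/-- Reducing coefficients commutes with the class of the chart evaluation: under
`(A/I)[T_j : j ≠ i] ≅ A[I/xᵢ]/(t)`, the reduction `p̄` of `p ∈ A[T_j : j ≠ i]` goes to the class of `eval p`.
[cite: StacksProject, Tag 0BIQ] -/
theorem blowupAlgebraQuotEquiv_map_eq_mk_eval (hx : IsQuasiRegular x) (p : MvPolynomial {j : Fin r // j ≠ i} A) :
    blowupAlgebraQuotEquiv x i hx (MvPolynomial.map (Ideal.Quotient.mk (Ideal.span (Set.range x))) p) =
      Ideal.Quotient.mk _ (blowupAlgebra.eval x i p) := by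
  rw [blowupAlgebraQuotEquiv_map]
  rfl

/-- **The Jacobian packaging.** If the affine piece of the projectivised tangent cone is SMOOTH over the centre in the
sense `1 ∈ (Φ̄ᵢ) + (∂Φ̄ᵢ/∂T_j : j ≠ i)` in `(A/I)[T_j : j ≠ i]`, then at every prime `𝔐` of `A[I/xᵢ]` containing `t` and
`g₁ = Φ(e) + tψ` some evaluated partial derivative `(∂Φᵢ/∂T_j)(e)` is NOT in `𝔐` (`x` quasi-regular; reduce modulo
`t` along `A[I/xᵢ]/(t) ≅ (A/I)[T]`). [cite: StacksProject, Tag 0BIQ] [OURS · L1 W4.5b] T-EBETA-PRIME helper. -/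
theorem exists_pderiv_coneTransform_notMem_of_mem_span (hx : IsQuasiRegular x) (Φ : MvPolynomial (Fin r) A)
    (hJ : (1 : MvPolynomial {j : Fin r // j ≠ i} (A ⧸ Ideal.span (Set.range x))) ∈
      Ideal.span {MvPolynomial.map (Ideal.Quotient.mk (Ideal.span (Set.range x))) (dehomogenize i Φ)} ⊔
        Ideal.span (Set.range fun j : {j : Fin r // j ≠ i} =>
          MvPolynomial.pderiv j (MvPolynomial.map (Ideal.Quotient.mk (Ideal.span (Set.range x))) (dehomogenize i Φ))))
    (ψ : blowupAlgebra (Ideal.span (Set.range x)) (x i))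
    (𝔐 : Ideal (blowupAlgebra (Ideal.span (Set.range x)) (x i))) [𝔐.IsPrime]
    (hxi : algebraMap A (blowupAlgebra (Ideal.span (Set.range x)) (x i)) (x i) ∈ 𝔐)
    (hg : MvPolynomial.aeval (blowupAlgebra.frac x i) Φ +
        algebraMap A (blowupAlgebra (Ideal.span (Set.range x)) (x i)) (x i) * ψ ∈ 𝔐) :
    ∃ j : {j : Fin r // j ≠ i}, blowupAlgebra.eval x i (MvPolynomial.pderiv j (dehomogenize i Φ)) ∉ 𝔐 := by
  classical
  by_contra hall
  simp only [not_exists, not_not] at hall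
  have hle : Ideal.span {algebraMap A (blowupAlgebra (Ideal.span (Set.range x)) (x i)) (x i)} ≤ 𝔐 :=
    (Ideal.span_singleton_le_iff_mem _).mpr hxi
  -- the test map `θ : (A/I)[T] ≅ B/(t) → B/𝔐`
  let θ : MvPolynomial {j : Fin r // j ≠ i} (A ⧸ Ideal.span (Set.range x)) →+*
      blowupAlgebra (Ideal.span (Set.range x)) (x i) ⧸ 𝔐 :=
    (Ideal.Quotient.factor hle).comp (blowupAlgebraQuotEquiv x i hx).toRingHom
  have hθ : ∀ p : MvPolynomial {j : Fin r // j ≠ i} A,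
      θ (MvPolynomial.map (Ideal.Quotient.mk (Ideal.span (Set.range x))) p) =
        Ideal.Quotient.mk 𝔐 (blowupAlgebra.eval x i p) := by
    intro p
    change Ideal.Quotient.factor hle (blowupAlgebraQuotEquiv x i hx _) = _
    rw [blowupAlgebraQuotEquiv_map_eq_mk_eval x i hx p, Ideal.Quotient.factor_mk]
  -- every generator of the Jacobian ideal dies under `θ`
  have hgen : Ideal.span {MvPolynomial.map (Ideal.Quotient.mk (Ideal.span (Set.range x))) (dehomogenize i Φ)} ⊔
      Ideal.span (Set.range fun j : {j : Fin r // j ≠ i} =>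
        MvPolynomial.pderiv j (MvPolynomial.map (Ideal.Quotient.mk (Ideal.span (Set.range x))) (dehomogenize i Φ))) ≤
      RingHom.ker θ := by
    refine sup_le ?_ ?_
    · rw [Ideal.span_singleton_le_iff_mem, RingHom.mem_ker, hθ, Ideal.Quotient.eq_zero_iff_mem,
        ← coneTransform_eq_eval_dehomogenize]
      have := 𝔐.sub_mem hg (𝔐.mul_mem_right ψ hxi)
      rwa [add_sub_cancel_right] at this
    · rw [Ideal.span_le]
      rintro _ ⟨j, rfl⟩
      rw [SetLike.mem_coe, RingHom.mem_ker]
      dsimp only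
      rw [MvPolynomial.pderiv_map, hθ, Ideal.Quotient.eq_zero_iff_mem]
      exact hall j
  have h1 : (1 : blowupAlgebra (Ideal.span (Set.range x)) (x i) ⧸ 𝔐) = 0 := by
    have := hgen hJ
    rwa [RingHom.mem_ker, map_one] at this
  exact (Ideal.Quotient.zero_ne_one_iff.mpr (Ideal.IsPrime.ne_top inferInstance)).symm h1

/-! ## Regularity along the exceptional divisor -/

/-- **Matsumura 14.2 at a point, in any model of the local ring.** `B` a regular ring, `𝔐` a prime, `g ∈ 𝔐` of order
one in `B_𝔐` (`g ∉ 𝔪²`); then for every localisation `S` of `B` at `𝔐` the quotient `S/(g)` is a regular local ring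
with `dim S/(g) + 1 = dim S` (the tree's `IsRegularLocalRing.quotient_span_singleton` on `Localization.AtPrime 𝔐`,
transported along `IsLocalization.algEquiv`). [cite: Matsumura1987, Thm. 14.2] -/
theorem isRegularLocalRing_quotient_span_algebraMap_of_notMem_sq {B : Type u} [CommRing B] [IsRegularRing B]
    (𝔐 : Ideal B) [𝔐.IsPrime] {g : B} (hg : g ∈ 𝔐)
    (hsq : algebraMap B (Localization.AtPrime 𝔐) g ∉ maximalIdeal (Localization.AtPrime 𝔐) ^ 2)
    (S : Type u) [CommRing S] [Algebra B S] [IsLocalization.AtPrime S 𝔐] :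
    IsRegularLocalRing (S ⧸ Ideal.span {algebraMap B S g}) ∧
      ringKrullDim (S ⧸ Ideal.span {algebraMap B S g}) + 1 = ringKrullDim S := by
  have hfm : algebraMap B (Localization.AtPrime 𝔐) g ∈ maximalIdeal (Localization.AtPrime 𝔐) := by
    rw [← Localization.AtPrime.map_eq_maximalIdeal]
    exact Ideal.mem_map_of_mem _ hg
  obtain ⟨hreg, hdim⟩ := IsRegularLocalRing.quotient_span_singleton hfm hsq
  let e : Localization.AtPrime 𝔐 ≃ₐ[B] S := IsLocalization.algEquiv 𝔐.primeCompl _ _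
  have hmap : (Ideal.span {algebraMap B S g}) =
      (Ideal.span {algebraMap B (Localization.AtPrime 𝔐) g}).map (e : Localization.AtPrime 𝔐 →+* S) := by
    rw [Ideal.map_span, Set.image_singleton, RingHom.coe_coe, AlgEquiv.commutes]
  let e' : (Localization.AtPrime 𝔐 ⧸ Ideal.span {algebraMap B (Localization.AtPrime 𝔐) g}) ≃+*
      (S ⧸ Ideal.span {algebraMap B S g}) :=
    Ideal.quotientEquiv _ _ (e : Localization.AtPrime 𝔐 ≃+* S) (by rw [hmap]; rfl)
  haveI := hreg
  refine ⟨IsRegularLocalRing.of_ringEquiv e', ?_⟩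
  rw [← ringKrullDim_eq_of_ringEquiv e', ← ringKrullDim_eq_of_ringEquiv (e : Localization.AtPrime 𝔐 ≃+* S)]
  exact hdim

/-- **The blow-up of `V(G)` is regular along the exceptional divisor at the smooth points of the tangent cone.**
`A` and `A/I` regular rings, `x` quasi-regular (so `A[I/xᵢ]` is a regular ring, Liu 8.1.19 (a),
`blowupAlgebra.isRegularRing`); `g₁ = Φ(e) + tψ` the strict transform of `G = Φ(x) + Ψ`. At a prime `𝔐` of the chart
`A[I/xᵢ]` ON the exceptional divisor (`t ∈ 𝔐`) and on the strict transform (`g₁ ∈ 𝔐`) at which some `(∂Φᵢ/∂T_j)(e)`,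
`j ≠ i`, is non-zero, the local ring `A[I/xᵢ]_𝔐/(g₁)` of the strict transform — in ANY model `S` of the localisation
— is a REGULAR local ring, of dimension `dim A[I/xᵢ]_𝔐 - 1` (Matsumura 14.2 via the derivative test).
[cite: Matsumura1987, Thm. 14.2] [cite: Liu2002, Thm. 8.1.19 (a)] [OURS · L1 W4.5b] T-EBETA-PRIME toward
`stub_elnat_three_isolated_nonabs` of crux `EquisingularLiftNat(Three)` (stmt-ResolutionOfSingularities-20038 / -20148);
NOT a statement of the manuscript. -/
theorem isRegularLocalRing_quotient_strictTransform [IsRegularRing A] (hx : IsQuasiRegular x)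
    [IsRegularRing (A ⧸ Ideal.span (Set.range x))] (Φ : MvPolynomial (Fin r) A)
    (ψ : blowupAlgebra (Ideal.span (Set.range x)) (x i))
    (𝔐 : Ideal (blowupAlgebra (Ideal.span (Set.range x)) (x i))) [𝔐.IsPrime]
    (hxi : algebraMap A (blowupAlgebra (Ideal.span (Set.range x)) (x i)) (x i) ∈ 𝔐)
    (hg : MvPolynomial.aeval (blowupAlgebra.frac x i) Φ +
        algebraMap A (blowupAlgebra (Ideal.span (Set.range x)) (x i)) (x i) * ψ ∈ 𝔐)
    (j : {j : Fin r // j ≠ i})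
    (hd : blowupAlgebra.eval x i (MvPolynomial.pderiv j (dehomogenize i Φ)) ∉ 𝔐)
    (S : Type u) [CommRing S] [Algebra (blowupAlgebra (Ideal.span (Set.range x)) (x i)) S]
    [IsLocalization.AtPrime S 𝔐] :
    IsRegularLocalRing (S ⧸ Ideal.span {algebraMap (blowupAlgebra (Ideal.span (Set.range x)) (x i)) S
        (MvPolynomial.aeval (blowupAlgebra.frac x i) Φ +
          algebraMap A (blowupAlgebra (Ideal.span (Set.range x)) (x i)) (x i) * ψ)}) ∧
      ringKrullDim (S ⧸ Ideal.span {algebraMap (blowupAlgebra (Ideal.span (Set.range x)) (x i)) S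
        (MvPolynomial.aeval (blowupAlgebra.frac x i) Φ +
          algebraMap A (blowupAlgebra (Ideal.span (Set.range x)) (x i)) (x i) * ψ)}) + 1 =
        ringKrullDim S := by
  haveI : IsRegularRing (blowupAlgebra (Ideal.span (Set.range x)) (x i)) := blowupAlgebra.isRegularRing x i hx
  exact isRegularLocalRing_quotient_span_algebraMap_of_notMem_sq 𝔐 hg
    (strictTransform_notMem_sq_of_pderiv_notMem x i hx Φ ψ 𝔐 hxi j hd) S

/-- **T-EBETA-PRIME, ring core: under the Jacobian condition the blow-up of `V(G)` along `V(I)` is regular at EVERY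
point of the exceptional divisor of the chart `D₊(xᵢ)`.** `A`, `A/I` regular rings, `x` quasi-regular,
`G = Φ(x) + Ψ` with `Φ` a form of degree `d`, `Ψ ∈ I^{d+1}`, strict transform `g₁ = Φ(e) + tψ` on `A[I/xᵢ]`; if
`1 ∈ (Φ̄ᵢ) + (∂Φ̄ᵢ/∂T_j : j ≠ i)` in `(A/I)[T_j : j ≠ i]` (the affine piece of the projectivised tangent cone is smooth
over the centre), then at every prime `𝔐 ⊇ (t, g₁)` of `A[I/xᵢ]` the local ring `A[I/xᵢ]_𝔐/(g₁)` of the strict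
transform (in any model `S` of the localisation) is regular. With `exists_quotient_strictTransform_equiv_blowupAlgebra`
(`A[I/xᵢ]/(g₁) ≅ (A/(G))[Ī/x̄ᵢ]`) and `exists_quotient_strictTransform_sup_equiv` (fibre `≅ (A/I)[T]/(Φ̄ᵢ)`) this is the
local admissibility of the (E-β′) centre `Bl_q(D)` at a tie point: regular along, and with exceptional fibre equal
to, the smooth plane curve `V(Φ̄)`. [cite: Matsumura1987, Thm. 14.2] [cite: Liu2002, Thm. 8.1.19 (a)]
[OURS · L1 W4.5b] T-EBETA-PRIME; NOT a statement of the manuscript. -/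
theorem isRegularLocalRing_quotient_strictTransform_of_mem_span [IsRegularRing A]
    (hx : IsQuasiRegular x) [IsRegularRing (A ⧸ Ideal.span (Set.range x))] (Φ : MvPolynomial (Fin r) A)
    (hJ : (1 : MvPolynomial {j : Fin r // j ≠ i} (A ⧸ Ideal.span (Set.range x))) ∈
      Ideal.span {MvPolynomial.map (Ideal.Quotient.mk (Ideal.span (Set.range x))) (dehomogenize i Φ)} ⊔
        Ideal.span (Set.range fun j : {j : Fin r // j ≠ i} =>
          MvPolynomial.pderiv j (MvPolynomial.map (Ideal.Quotient.mk (Ideal.span (Set.range x))) (dehomogenize i Φ))))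
    (ψ : blowupAlgebra (Ideal.span (Set.range x)) (x i))
    (𝔐 : Ideal (blowupAlgebra (Ideal.span (Set.range x)) (x i))) [𝔐.IsPrime]
    (hxi : algebraMap A (blowupAlgebra (Ideal.span (Set.range x)) (x i)) (x i) ∈ 𝔐)
    (hg : MvPolynomial.aeval (blowupAlgebra.frac x i) Φ +
        algebraMap A (blowupAlgebra (Ideal.span (Set.range x)) (x i)) (x i) * ψ ∈ 𝔐)
    (S : Type u) [CommRing S] [Algebra (blowupAlgebra (Ideal.span (Set.range x)) (x i)) S]
    [IsLocalization.AtPrime S 𝔐] :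
    IsRegularLocalRing (S ⧸ Ideal.span {algebraMap (blowupAlgebra (Ideal.span (Set.range x)) (x i)) S
        (MvPolynomial.aeval (blowupAlgebra.frac x i) Φ +
          algebraMap A (blowupAlgebra (Ideal.span (Set.range x)) (x i)) (x i) * ψ)}) := by
  obtain ⟨j, hj⟩ := exists_pderiv_coneTransform_notMem_of_mem_span x i hx Φ hJ ψ 𝔐 hxi hg
  exact (isRegularLocalRing_quotient_strictTransform x i hx Φ ψ 𝔐 hxi hg j hj S).1

/-- **The strict transform chart is a REGULAR RING** when, in addition to the Jacobian condition along the
exceptional divisor, `g₁` has order one at its points OFF the exceptional divisor (there `Bl V(G) ≅ V(G) ∖ V(I)`, so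
this says `V(G)` is regular off the centre, over the chart): `A[I/xᵢ]/(g₁)` — equivalently `(A/(G))[Ī/x̄ᵢ]`,
`exists_quotient_strictTransform_equiv_blowupAlgebra` — is a regular ring (Matsumura 14.2 at every maximal ideal,
19.3). [cite: Matsumura1987, Thm. 14.2, Thm. 19.3] [cite: Liu2002, Thm. 8.1.19 (a)] [OURS · L1 W4.5b] T-EBETA-PRIME;
NOT a statement of the manuscript. -/
theorem isRegularRing_quotient_strictTransform_of_mem_span [IsRegularRing A]
    (hx : IsQuasiRegular x) [IsRegularRing (A ⧸ Ideal.span (Set.range x))] (Φ : MvPolynomial (Fin r) A)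
    (hJ : (1 : MvPolynomial {j : Fin r // j ≠ i} (A ⧸ Ideal.span (Set.range x))) ∈
      Ideal.span {MvPolynomial.map (Ideal.Quotient.mk (Ideal.span (Set.range x))) (dehomogenize i Φ)} ⊔
        Ideal.span (Set.range fun j : {j : Fin r // j ≠ i} =>
          MvPolynomial.pderiv j (MvPolynomial.map (Ideal.Quotient.mk (Ideal.span (Set.range x))) (dehomogenize i Φ))))
    (ψ : blowupAlgebra (Ideal.span (Set.range x)) (x i))
    (hoff : ∀ (𝔐 : Ideal (blowupAlgebra (Ideal.span (Set.range x)) (x i))) [𝔐.IsMaximal],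
      MvPolynomial.aeval (blowupAlgebra.frac x i) Φ +
          algebraMap A (blowupAlgebra (Ideal.span (Set.range x)) (x i)) (x i) * ψ ∈ 𝔐 →
      algebraMap A (blowupAlgebra (Ideal.span (Set.range x)) (x i)) (x i) ∉ 𝔐 →
      algebraMap (blowupAlgebra (Ideal.span (Set.range x)) (x i)) (Localization.AtPrime 𝔐)
          (MvPolynomial.aeval (blowupAlgebra.frac x i) Φ +
            algebraMap A (blowupAlgebra (Ideal.span (Set.range x)) (x i)) (x i) * ψ) ∉
        maximalIdeal (Localization.AtPrime 𝔐) ^ 2) :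
    IsRegularRing (blowupAlgebra (Ideal.span (Set.range x)) (x i) ⧸ Ideal.span
      {MvPolynomial.aeval (blowupAlgebra.frac x i) Φ +
        algebraMap A (blowupAlgebra (Ideal.span (Set.range x)) (x i)) (x i) * ψ}) := by
  haveI : IsRegularRing (blowupAlgebra (Ideal.span (Set.range x)) (x i)) := blowupAlgebra.isRegularRing x i hx
  refine isRegularRing_quotient_span_singleton_of_forall_notMem_sq _ fun 𝔐 _ hg => ?_
  by_cases hxi : algebraMap A (blowupAlgebra (Ideal.span (Set.range x)) (x i)) (x i) ∈ 𝔐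
  · obtain ⟨j, hj⟩ := exists_pderiv_coneTransform_notMem_of_mem_span x i hx Φ hJ ψ 𝔐 hxi hg
    exact strictTransform_notMem_sq_of_pderiv_notMem x i hx Φ ψ 𝔐 hxi j hj
  · exact hoff 𝔐 hg hxi

end OrderOne

end Summit.ResolutionOfSingularities.ResolutionOfSingularities.Cruxes.EquisingularLiftNat.Sections

end
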